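import Summits.HodgeConjecture.CorCM.SexticCMFourTypesSignRelation
import Literature.AlgebraicGeometry.Pohlmann1968.DivisorClassesCMAlgebra
import HarnessLib

/-!
# Four CM types of ONE sextic CM field: an explicit exceptional Hodge class of type `(2,2)` on the product
# `X₀ × X₁ × X₂ × X₃` of their realisations

COR-CM (cell `pub-hodgecm2`), seat p2 gen 21; count-neutral; theorems only, no definition, no named fact, no `sorry`.
Sequel of `CorCM/GenericCMFieldSameFieldFamiliesHodge` (pair-flip fields: four pairwise non-isogenous CM abelian
varieties with CM by a sextic pair-flip field carry an exceptional class on SOME product, by the Hazama–Murty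
criterion).  Here the class is LOCATED, and the pair-flip hypothesis is REMOVED:

* §1 (file `CorCM/SexticCMFourTypesSignRelation`): for ANY sextic CM field `K` and any four CM types `Φ_i` with
  `Φ_j ∉ {Φ_i, Φ̄_i}` the type vectors satisfy a SIGN RELATION `Σ_i η_i u_{Φ_i} = 0`, `η_i = ±1`
  (`exists_sign_relation_of_finrank_eq_six`).
* §2 THE BALANCED SET.  For ANY CM field and four types with a sign relation, the `4`-set
  `S = {(i, s^{η_i})}_i ⊆ ⊔_i Hom(K, ℂ)` (`s⁺ = s`, `s⁻ = s̄`, any embedding `s`) is Galois-balanced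
  (`mem_pohlmannSetsAlg_two`: under `τ ∈ Aut(ℂ)` the four memberships `[τ s^{η_i} ∈ Φ_i]` are the signs
  `η_i u_{Φ_i}(τ s)`, which sum to `0`, so exactly two hold), and is not a disjoint union of two balanced pairs when the
  types are pairwise inequivalent (`not_mem_pohlmannDivisorSetsAlg_two`: a balanced pair `{(i, s^{η_i}), (j, s^{η_j})}`
  forces `η_i u_{Φ_i} = −η_j u_{Φ_j}`, i.e. `Φ_j ∈ {Φ_i, Φ̄_i}`, by transitivity of `Aut(ℂ)` on `Hom(K, ℂ)`).
* §3 GEOMETRY (`Pohlmann1968_thm1_cmAlgebra` via `exists_exceptional_biproduct_iff`): for every family of realisations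
  `X_i` of the `Φ_i` — **`exists_exceptional_two_biproduct_of_signRelation`** (any CM field, four pairwise inequivalent
  types with a sign relation) and **`exists_exceptional_two_biproduct_of_finrank_eq_six`** (ANY SEXTIC CM field, any
  four pairwise inequivalent CM types; e.g. four pairwise non-isogenous simple CM abelian threefolds with CM by `K`,
  `exists_exceptional_two_biproduct_of_not_isIsogenous`): **the 12-fold `X₀ × X₁ × X₂ × X₃` carries a rational
  `(2,2)`-class outside the `ℂ`-span of products of divisor classes** (it lives in the Künneth component
  `H¹(X₀)⊗H¹(X₁)⊗H¹(X₂)⊗H¹(X₃)`).  Whether such classes are algebraic is open.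
-/

noncomputable section

open CategoryTheory CategoryTheory.Limits NumberField NumberField.ComplexEmbedding
open scoped BigOperators

namespace Summit.HodgeConjecture.CorCM.GenericCMField

open Literature.NumberTheory.ComplexMultiplication
open Literature.AlgebraicGeometry.Motives (AbelianVariety CMType)
open Literature.AlgebraicGeometry.HodgeTheory
open Literature.AlgebraicGeometry.ComplexMultiplication (IsCMTypeRealisation)
open Literature.AlgebraicGeometry.VanGeemen1994 (hodgeClassSpan)
open Literature.AlgebraicGeometry.Pohlmann1968
open Literature.Barriers.HodgeConjecture (divisorClassesSpan)

/-! ## §0 Counting helpers -/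

section Counting

/-- `#{x ∈ s | Q x}` as a sum of indicators. -/
private theorem ncard_sep_eq_sum {α : Type*} (s : Finset α) (Q : α → Prop) [DecidablePred Q] :
    {x | x ∈ s ∧ Q x}.ncard = ∑ x ∈ s, if Q x then 1 else 0 := by
  have h : {x | x ∈ s ∧ Q x} = ↑(s.filter Q) := by
    ext x
    simp
  rw [h, Set.ncard_coe_finset, Finset.card_filter]

/-- A sum over four distinct points. -/
private theorem sum_quad {α N : Type*} [DecidableEq α] [AddCommMonoid N] {a b c d : α} (hab : a ≠ b) (hac : a ≠ c)
    (had : a ≠ d) (hbc : b ≠ c) (hbd : b ≠ d) (hcd : c ≠ d) (f : α → N) :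
    ∑ x ∈ ({a, b, c, d} : Finset α), f x = f a + f b + f c + f d := by
  rw [Finset.sum_insert (by simp [hab, hac, had]), Finset.sum_insert (by simp [hbc, hbd]), Finset.sum_pair hcd]
  simp only [add_assoc]

/-- Four distinct points form a `4`-set. -/
private theorem card_quad {α : Type*} [DecidableEq α] {a b c d : α} (hab : a ≠ b) (hac : a ≠ c) (had : a ≠ d)
    (hbc : b ≠ c) (hbd : b ≠ d) (hcd : c ≠ d) : ({a, b, c, d} : Finset α).card = 4 := by
  rw [Finset.card_insert_of_notMem (by simp [hab, hac, had]), Finset.card_insert_of_notMem (by simp [hbc, hbd]),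
    Finset.card_pair hcd]

/-- Four propositions whose signs `±1` (`+1` iff true) sum to `0`: exactly two hold. -/
private theorem ite_balance_of_sum {A B C D : Prop} [Decidable A] [Decidable B] [Decidable C] [Decidable D]
    {a b c d : ℚ} (ha : a = if A then 1 else -1) (hb : b = if B then 1 else -1) (hc : c = if C then 1 else -1)
    (hd : d = if D then 1 else -1) (hsum : a + b + c + d = 0) :
    (if A then 1 else 0) + (if B then 1 else 0) + (if C then 1 else 0) + (if D then 1 else 0) =
      (if ¬A then 1 else 0) + (if ¬B then 1 else 0) + (if ¬C then 1 else 0) + (if ¬D then 1 else 0) := by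
  subst ha hb hc hd
  by_cases hA : A <;> by_cases hB : B <;> by_cases hC : C <;> by_cases hD : D <;> simp_all <;> norm_num at hsum

/-- A balanced pair has exactly one member in the type. -/
private theorem iff_not_of_ite_add {A B : Prop} [Decidable A] [Decidable B]
    (h : (if A then 1 else 0) + (if B then 1 else 0) = (if ¬A then 1 else 0) + (if ¬B then 1 else 0)) :
    A ↔ ¬B := by
  by_cases hA : A <;> by_cases hB : B <;> simp_all

/-- Products of signs are signs. -/
private theorem sign_mul {x y : ℚ} (hx : x = 1 ∨ x = -1) (hy : y = 1 ∨ y = -1) : x * y = 1 ∨ x * y = -1 := by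
  rcases hx with rfl | rfl <;> rcases hy with rfl | rfl <;> norm_num

/-- Two signs of which exactly one is `+1` are opposite. -/
private theorem eq_neg_of_iff {a b : ℚ} (ha : a = 1 ∨ a = -1) (hb : b = 1 ∨ b = -1) (h : a = 1 ↔ ¬b = 1) :
    a = -b := by
  rcases ha with rfl | rfl <;> rcases hb with rfl | rfl
  · norm_num at h
  · norm_num
  · norm_num
  · norm_num at h

end Counting

/-! ## §2 The balanced `4`-set of a sign relation (any CM field) -/

section Balanced

open scoped Classical

variable {K : Type} [Field K] [NumberField K] [IsCMField K]

/-- `s⁺ = s`, `s⁻ = s̄`: the membership of the embedding attached to a sign, read off the type vector. -/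
private theorem sgnEmb_mem_iff (Φ : CMType K) {η : ℚ} (hη : η = 1 ∨ η = -1) (τ : ℂ ≃+* ℂ) (s : K →+* ℂ) :
    (τ : ℂ →+* ℂ).comp (if η = 1 then s else conjugate s) ∈ Φ.1 ↔
      η * antiVec Φ.1 (1 : ℂ ≃+* ℂ) (τ • s) = 1 := by
  have hodd : antiVec Φ.1 (1 : ℂ ≃+* ℂ) (τ • conjugate s) = -antiVec Φ.1 (1 : ℂ ≃+* ℂ) (τ • s) := by
    have h := (isCMTypeWith_conj Φ).translateInd_rho_smul (1 : ℂ ≃+* ℂ) (τ • s)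
    rw [← smul_conj_smul, conj_smul_eq_conjugate] at h
    simp only [antiVec]
    rw [h]
    ring
  rcases hη with rfl | rfl
  · rw [if_pos rfl, one_mul, antiVec_one_apply_eq_one_iff]
    rfl
  · rw [if_neg (by norm_num)]
    change τ • conjugate s ∈ Φ.1 ↔ _
    rw [← antiVec_one_apply_eq_one_iff, hodd]
    constructor <;> intro h <;> linarith

omit [NumberField K] [IsCMField K] in
/-- The four points `(i, s^{η_i})` are pairwise distinct (distinct slots). -/
private theorem sigma_ne {i j : Fin 4} (hij : i ≠ j) (a b : K →+* ℂ) :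
    (⟨i, a⟩ : (k : Fin 4) × ((fun _ : Fin 4 => K) k →+* ℂ)) ≠ ⟨j, b⟩ :=
  fun h => hij (congrArg Sigma.fst h)

/-- **The `4`-set `S = {(i, s^{η_i})}_{i<4}` of a sign relation `Σ_i η_i u_{Φ_i} = 0` is Galois-balanced**: for every
`τ ∈ Aut(ℂ)` exactly two of the `τ s^{η_i}` lie in their types (the four signs `η_i u_{Φ_i}(τ s)` sum to zero). -/
theorem mem_pohlmannSetsAlg_two (Φ : Fin 4 → CMType K) {η : Fin 4 → ℚ} (hη : ∀ i, η i = 1 ∨ η i = -1)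
    (hrel : ∀ s : K →+* ℂ, ∑ i, η i * antiVec (Φ i).1 (1 : ℂ ≃+* ℂ) s = 0) (s : K →+* ℂ) :
    ({⟨0, if η 0 = 1 then s else conjugate s⟩, ⟨1, if η 1 = 1 then s else conjugate s⟩,
        ⟨2, if η 2 = 1 then s else conjugate s⟩, ⟨3, if η 3 = 1 then s else conjugate s⟩} :
        Finset ((k : Fin 4) × ((fun _ : Fin 4 => K) k →+* ℂ))) ∈
      pohlmannSetsAlg (K := fun _ : Fin 4 => K) Φ 2 := by
  have h01 := sigma_ne (K := K) (show (0 : Fin 4) ≠ 1 by decide)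
    (if η 0 = 1 then s else conjugate s) (if η 1 = 1 then s else conjugate s)
  have h02 := sigma_ne (K := K) (show (0 : Fin 4) ≠ 2 by decide)
    (if η 0 = 1 then s else conjugate s) (if η 2 = 1 then s else conjugate s)
  have h03 := sigma_ne (K := K) (show (0 : Fin 4) ≠ 3 by decide)
    (if η 0 = 1 then s else conjugate s) (if η 3 = 1 then s else conjugate s)
  have h12 := sigma_ne (K := K) (show (1 : Fin 4) ≠ 2 by decide)
    (if η 1 = 1 then s else conjugate s) (if η 2 = 1 then s else conjugate s)
  have h13 := sigma_ne (K := K) (show (1 : Fin 4) ≠ 3 by decide)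
    (if η 1 = 1 then s else conjugate s) (if η 3 = 1 then s else conjugate s)
  have h23 := sigma_ne (K := K) (show (2 : Fin 4) ≠ 3 by decide)
    (if η 2 = 1 then s else conjugate s) (if η 3 = 1 then s else conjugate s)
  refine ⟨card_quad h01 h02 h03 h12 h13 h23, fun τ => ?_⟩
  rw [ncard_sep_eq_sum, ncard_sep_eq_sum, sum_quad h01 h02 h03 h12 h13 h23, sum_quad h01 h02 h03 h12 h13 h23]
  have hsum := hrel (τ • s)
  rw [Fin.sum_univ_four] at hsum
  refine ite_balance_of_sum (a := η 0 * antiVec (Φ 0).1 (1 : ℂ ≃+* ℂ) (τ • s))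
    (b := η 1 * antiVec (Φ 1).1 (1 : ℂ ≃+* ℂ) (τ • s)) (c := η 2 * antiVec (Φ 2).1 (1 : ℂ ≃+* ℂ) (τ • s))
    (d := η 3 * antiVec (Φ 3).1 (1 : ℂ ≃+* ℂ) (τ • s)) ?_ ?_ ?_ ?_ hsum
  all_goals
    rw [sgnEmb_mem_iff (Φ _) (hη _) τ s]
    rcases hη _ with h | h <;> rcases antiVec_one_apply_eq_or (Φ _) (τ • s) with h' | h' <;>
      (rw [h, h']; try norm_num)

/-- **… and is not a disjoint union of two balanced pairs when the types are pairwise inequivalent**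
(`u_{Φ_j} ≠ ±u_{Φ_i}`): a balanced pair `{(i, s^{η_i}), (j, s^{η_j})}` would give `η_i u_{Φ_i}(τs) = −η_j u_{Φ_j}(τs)` for
all `τ`, i.e. `u_{Φ_j} = ∓u_{Φ_i}` by transitivity of `Aut(ℂ)` on `Hom(K, ℂ)`. -/
theorem not_mem_pohlmannDivisorSetsAlg_two (Φ : Fin 4 → CMType K) {η : Fin 4 → ℚ} (hη : ∀ i, η i = 1 ∨ η i = -1)
    (hpair : ∀ i j, i ≠ j → antiVec (Φ j).1 (1 : ℂ ≃+* ℂ) ≠ antiVec (Φ i).1 (1 : ℂ ≃+* ℂ) ∧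
      antiVec (Φ j).1 (1 : ℂ ≃+* ℂ) ≠ -antiVec (Φ i).1 (1 : ℂ ≃+* ℂ)) (s : K →+* ℂ) :
    ({⟨0, if η 0 = 1 then s else conjugate s⟩, ⟨1, if η 1 = 1 then s else conjugate s⟩,
        ⟨2, if η 2 = 1 then s else conjugate s⟩, ⟨3, if η 3 = 1 then s else conjugate s⟩} :
        Finset ((k : Fin 4) × ((fun _ : Fin 4 => K) k →+* ℂ))) ∉
      pohlmannDivisorSetsAlg (K := fun _ : Fin 4 => K) Φ 2 := by
  classical
  set e : Fin 4 → (K →+* ℂ) := fun i => if η i = 1 then s else conjugate s with he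
  set P : Finset ((k : Fin 4) × ((fun _ : Fin 4 => K) k →+* ℂ)) := {⟨0, e 0⟩, ⟨1, e 1⟩, ⟨2, e 2⟩, ⟨3, e 3⟩}
    with hPdef
  intro hP
  rw [pohlmannDivisorSetsAlg_def] at hP
  obtain ⟨t₁, ht₁, t₂, ht₂, hdisj, hPst⟩ := mem_disjointUnionsOf_succ.1 hP
  obtain ⟨t₀, ht₀, t₁', ht₁', hdisj', rfl⟩ := mem_disjointUnionsOf_succ.1 ht₁
  rw [mem_disjointUnionsOf_zero] at ht₀
  subst ht₀
  have hmem : (⟨0, e 0⟩ : (k : Fin 4) × ((fun _ : Fin 4 => K) k →+* ℂ)) ∈ P := by simp [hPdef]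
  -- a balanced pair `T ⊆ P` through `(0, e 0)`
  obtain ⟨T, hT, h0T, hTP⟩ : ∃ T ∈ pohlmannSetsAlg (K := fun _ : Fin 4 => K) Φ 1,
      (⟨0, e 0⟩ : (k : Fin 4) × ((fun _ : Fin 4 => K) k →+* ℂ)) ∈ T ∧ T ⊆ P := by
    rw [hPst, Finset.mem_disjUnion, Finset.mem_disjUnion] at hmem
    rcases hmem with (h | h) | h
    · exact absurd h (Finset.notMem_empty _)
    · exact ⟨t₁', ht₁', h, fun x hx => by
        rw [hPst]; exact Finset.mem_disjUnion.2 (Or.inl (Finset.mem_disjUnion.2 (Or.inr hx)))⟩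
    · exact ⟨t₂, ht₂, h, fun x hx => by rw [hPst]; exact Finset.mem_disjUnion.2 (Or.inr hx)⟩
  obtain ⟨hTcard, hTbal⟩ := hT
  obtain ⟨x, y, hxy, hTxy⟩ := Finset.card_eq_two.1 (by simpa using hTcard)
  obtain ⟨w, hw0, hwP, hbal⟩ : ∃ w, w ≠ (⟨0, e 0⟩ : (k : Fin 4) × ((fun _ : Fin 4 => K) k →+* ℂ)) ∧ w ∈ P ∧
      IsGaloisBalancedAlg (K := fun _ : Fin 4 => K) Φ {⟨0, e 0⟩, w} := by
    rw [hTxy] at h0T hTP hTbal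
    simp only [Finset.mem_insert, Finset.mem_singleton] at h0T
    rcases h0T with rfl | rfl
    · exact ⟨y, hxy.symm, hTP (by simp), hTbal⟩
    · exact ⟨x, hxy, hTP (by simp), by rwa [Finset.pair_comm] at hTbal⟩
  -- the partner is `(j, e j)` for some `j ≠ 0`
  obtain ⟨j, hj0, rfl⟩ : ∃ j : Fin 4, j ≠ 0 ∧ w = ⟨j, e j⟩ := by
    have hwP' : w = ⟨0, e 0⟩ ∨ w = ⟨1, e 1⟩ ∨ w = ⟨2, e 2⟩ ∨ w = ⟨3, e 3⟩ := by simpa [hPdef] using hwP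
    rcases hwP' with rfl | rfl | rfl | rfl
    · exact (hw0 rfl).elim
    · exact ⟨1, by decide, rfl⟩
    · exact ⟨2, by decide, rfl⟩
    · exact ⟨3, by decide, rfl⟩
  -- exactly one member of the pair lies in the types, for every `τ`: `η₀ u₀(τs) = -η_j u_j(τs)`
  have hone : ∀ τ : ℂ ≃+* ℂ,
      η 0 * antiVec (Φ 0).1 (1 : ℂ ≃+* ℂ) (τ • s) = -(η j * antiVec (Φ j).1 (1 : ℂ ≃+* ℂ) (τ • s)) := by
    intro τ
    have h := hbal τ
    rw [ncard_sep_eq_sum, ncard_sep_eq_sum, Finset.sum_pair hw0.symm, Finset.sum_pair hw0.symm] at h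
    have h' := iff_not_of_ite_add h
    change ((τ : ℂ →+* ℂ).comp (e 0) ∈ (Φ 0).1 ↔ ¬(τ : ℂ →+* ℂ).comp (e j) ∈ (Φ j).1) at h'
    rw [he, sgnEmb_mem_iff (Φ 0) (hη 0) τ s, sgnEmb_mem_iff (Φ j) (hη j) τ s] at h'
    exact eq_neg_of_iff (sign_mul (hη 0) (antiVec_one_apply_eq_or _ _))
      (sign_mul (hη j) (antiVec_one_apply_eq_or _ _)) h'
  -- transitivity of `Aut(ℂ)` on `Hom(K, ℂ)`: `η₀ u₀ = -η_j u_j` everywhere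
  haveI := isPretransitive_ringEquiv_complex (K := K)
  have hall : ∀ t : K →+* ℂ,
      η 0 * antiVec (Φ 0).1 (1 : ℂ ≃+* ℂ) t = -(η j * antiVec (Φ j).1 (1 : ℂ ≃+* ℂ) t) := fun t => by
    obtain ⟨τ, rfl⟩ := MulAction.exists_smul_eq (ℂ ≃+* ℂ) s t
    exact hone τ
  rcases hη 0 with h0 | h0 <;> rcases hη j with h1 | h1
  · exact (hpair 0 j hj0.symm |>.symm |> fun h => (hpair j 0 hj0).2) (funext fun t => by
      have := hall t; rw [h0, h1] at this; rw [Pi.neg_apply]; linarith)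
  · exact (hpair j 0 hj0).1 (funext fun t => by have := hall t; rw [h0, h1] at this; linarith)
  · exact (hpair j 0 hj0).1 (funext fun t => by have := hall t; rw [h0, h1] at this; linarith)
  · exact (hpair j 0 hj0).2 (funext fun t => by have := hall t; rw [h0, h1] at this; rw [Pi.neg_apply]; linarith)

end Balanced

/-! ## §3 The exceptional `(2,2)`-class on `X₀ × X₁ × X₂ × X₃` -/

section Geometry

open scoped Classical

variable {K : Type} [Field K] [NumberField K] [IsCMField K] {Φ : Fin 4 → CMType K}
  {A : Fin 4 → AbelianVariety ℂ} {ι : ∀ i, 𝓞 K →+* End (A i)}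
  {θ : ∀ i, K →+* Module.End ℂ (complexBetti (A i).X 1)}

/-- **Four pairwise inequivalent CM types of ONE CM field with a sign relation `Σ η_i u_{Φ_i} = 0`: the product
`X₀ × X₁ × X₂ × X₃` of ANY realisations carries a rational `(2,2)`-class outside the `ℂ`-span of products of divisor
classes.** -/
theorem exists_exceptional_two_biproduct_of_signRelation
    (hpair : ∀ i j, i ≠ j → antiVec (Φ j).1 (1 : ℂ ≃+* ℂ) ≠ antiVec (Φ i).1 (1 : ℂ ≃+* ℂ) ∧
      antiVec (Φ j).1 (1 : ℂ ≃+* ℂ) ≠ -antiVec (Φ i).1 (1 : ℂ ≃+* ℂ))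
    {η : Fin 4 → ℚ} (hη : ∀ i, η i = 1 ∨ η i = -1)
    (hrel : ∀ s : K →+* ℂ, ∑ i, η i * antiVec (Φ i).1 (1 : ℂ ≃+* ℂ) s = 0)
    (hA : ∀ i, IsCMTypeRealisation (Φ i) (A i) (ι i) (θ i)) :
    ∃ c : complexBetti (⨁ A).X (2 * 2), IsRationalClass c ∧
      IsOfHodgeType (⨁ A).dim (⨁ A).X (2 * 2) 2 2 c ∧ c ∉ divisorClassesSpan (⨁ A).X (⨁ A).dim 2 := by
  classical
  obtain ⟨s⟩ : Nonempty (K →+* ℂ) := inferInstance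
  exact (exists_exceptional_biproduct_iff (K := fun _ : Fin 4 => K) hA 2).2
    ⟨_, mem_pohlmannSetsAlg_two Φ hη hrel s, not_mem_pohlmannDivisorSetsAlg_two Φ hη hpair s⟩

/-- **ANY SEXTIC CM field, any four pairwise inequivalent CM types (`Φ_j ∉ {Φ_i, Φ̄_i}`), any realisations: the 12-fold
`X₀ × X₁ × X₂ × X₃` carries a rational `(2,2)`-class outside the `ℂ`-span of products of divisor classes.** -/
theorem exists_exceptional_two_biproduct_of_finrank_eq_six (h6 : Module.finrank ℚ K = 6)
    (hpair : ∀ i j, i ≠ j → antiVec (Φ j).1 (1 : ℂ ≃+* ℂ) ≠ antiVec (Φ i).1 (1 : ℂ ≃+* ℂ) ∧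
      antiVec (Φ j).1 (1 : ℂ ≃+* ℂ) ≠ -antiVec (Φ i).1 (1 : ℂ ≃+* ℂ))
    (hA : ∀ i, IsCMTypeRealisation (Φ i) (A i) (ι i) (θ i)) :
    ∃ c : complexBetti (⨁ A).X (2 * 2), IsRationalClass c ∧
      IsOfHodgeType (⨁ A).dim (⨁ A).X (2 * 2) 2 2 c ∧ c ∉ divisorClassesSpan (⨁ A).X (⨁ A).dim 2 := by
  obtain ⟨η, hη, hrel⟩ := exists_sign_relation_of_finrank_eq_six h6 Φ hpair
  exact exists_exceptional_two_biproduct_of_signRelation hpair hη hrel hA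

/-- **Four pairwise non-isogenous CM abelian threefolds `X₀, …, X₃` with CM by ONE sextic CM field `K`: the 12-fold
`X₀ × X₁ × X₂ × X₃` carries a rational `(2,2)`-class which is not in the `ℂ`-span of products of divisor classes** — an
explicit Hodge class whose algebraicity is an open instance of the Hodge conjecture (for `K` without imaginary quadratic
subfield these are the four isogeny classes of simple CM threefolds with CM by `K`, cf. `CorCM/SexticCMFieldPairFlip`). -/
theorem exists_exceptional_two_biproduct_of_not_isIsogenous (h6 : Module.finrank ℚ K = 6)
    (hA : ∀ i, IsCMTypeRealisation (Φ i) (A i) (ι i) (θ i))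
    (hniso : ∀ i j, i ≠ j → ¬AbelianVariety.IsIsogenous (A i) (A j)) :
    ∃ c : complexBetti (⨁ A).X (2 * 2), IsRationalClass c ∧
      IsOfHodgeType (⨁ A).dim (⨁ A).X (2 * 2) 2 2 c ∧ c ∉ divisorClassesSpan (⨁ A).X (⨁ A).dim 2 :=
  exists_exceptional_two_biproduct_of_finrank_eq_six h6
    (fun i j hij => antiVec_ne_of_not_isIsogenous (hA i) (hA j) (hniso i j hij)) hA

end Geometry

end Summit.HodgeConjecture.CorCM.GenericCMField
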